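import Literature.LinearAlgebra.Matrix.SecondOrderDampedTypeCount
import Literature.MathematicalPhysics.PowerSystems.KuramotoSyncExponentialStability
import HarnessLib

/-!
# The type of a droop / Kuramoto fixed point: the index of the reduced linearised Laplacian

For the first-order droop-controlled inverter network (Aux) `D_iθ̇_i = P̃_i − Σ_j a_ij sin(θ_i − θ_j)`
[SimpsonporcoDorflerBullo2013, §3] — equivalently the lossless non-uniform Kuramoto model
(`NonuniformKuramoto.toDroopNetwork`, SPDB2013 Lemma 1) — the linearisation at a fixed point `θ*` is
`auxJac θ* = −D⁻¹L(θ*)` with `L(θ*)` the Laplacian of the weights `a_ij cos(θ*_i − θ*_j)`.  This is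
the «dimension-reduction system» (6.3) of [Chiang1995, §6.2], and Theorem 6.7 (R1) there reads the
TYPE of `θ*` (number of Jacobian eigenvalues with positive real part, [Chiang1995, §2 p. 32]) off the
reduced Hessian.  We package the generic count
`Literature.LinearAlgebra.Matrix.countP_roots_charpoly_firstOrderJac_of_rowSum_zero` for this record:

* `DroopNetwork.countP_roots_charpoly_auxJac_modRotation` — `|Y|` symmetric, `D_i > 0`, the reduced
  `L(θ*)` off a reference node `i₀` nonsingular: the root counts of `χ_{auxJac θ*}` over `ℂ` are
  `(#{λ(L_ref) < 0}, #{λ(L_ref) > 0}, 1)` — type `k` iff the reduced linearised Laplacian has `k`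
  negative eigenvalues; the single zero root is the rotation.
* `DroopNetwork.typeZero_auxJac_of_posCurvature` / `_of_arc` — the PSD + kernel certificate of the
  printed proof (e.g. the arc `|θ*_i − θ*_j| < π/2` on a connected network, `posCurvature_of_arc`) gives
  counts `(0, n − 1, 1)`: a hyperbolic sink modulo rotation («all eigenvalues real and negative»).
* `DroopNetwork.typeMax_auxJac_of_negCurvature` — a negative form off the constants gives
  `(n − 1, 0, 1)`.
* `NonuniformKuramoto.typeZero_toDroopNetwork_auxJac_of_posCurvature`,
  `NonuniformKuramoto.countP_roots_charpoly_toDroopNetwork_auxJac` — the same for the Kuramoto record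
  (weights `P_ij cos(θ*_i − θ*_j)`).

## References
* [SimpsonporcoDorflerBullo2013] J. W. Simpson-Porco, F. Dörfler, F. Bullo, *Synchronization and power
  sharing for droop-controlled inverters in islanded microgrids*, Automatica 49 (2013), §3 Thm 2 (b).
* [Chiang1995] H.-D. Chiang, C.-C. Chu, G. Cauley, Proc. IEEE 83 (1995), §6.2 (6.3), Thm 6.7 (R1).
* [ManikTimmeWitthaut2017] D. Manik, M. Timme, D. Witthaut, Chaos 27 (2017), §2 Lemma 1.
* [DorflerChertkovBullo2013] F. Dörfler, M. Chertkov, F. Bullo, PNAS 110 (2013), SI §3.1 Lemma 2.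
-/

open Finset Matrix Polynomial Literature.LinearAlgebra.Matrix

namespace Literature.MathematicalPhysics.PowerSystems

namespace DroopNetwork

variable {n : ℕ} {N : DroopNetwork n}

/-- `auxJac θ* = −D⁻¹L(θ*)` is the generic first-order Jacobian of `L(θ*)`.
[cite: SimpsonporcoDorflerBullo2013, §3 proof of Theorem 2 (b) («the linearization of the dynamics (Aux)»)] -/
theorem auxJac_eq_firstOrderJac (θs : Fin n → ℝ) : N.auxJac θs = firstOrderJac (N.lap θs) N.Dc :=
  Matrix.ext fun _ _ => rfl

/-- Zero row sums of `L(θ*)` (rotational invariance). [cite: SimpsonporcoDorflerBullo2013, §3 proof of Theorem 2 («rotational invariance»)] -/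
theorem sum_lap_row (θs : Fin n → ℝ) (i : Fin n) : ∑ k, N.lap θs i k = 0 := by
  simp only [lap, Finset.sum_sub_distrib, Finset.sum_ite_eq, Finset.mem_univ, if_true, sub_self]

/-- `L(θ*)` is symmetric for `|Y|` symmetric. [cite: SimpsonporcoDorflerBullo2013, §3 proof of Theorem 2 (b) («`L(θ*) = B diag(…) Bᵀ`»)] -/
theorem lap_isHermitian (hY : ∀ i j, N.Yabs i j = N.Yabs j i) (θs : Fin n → ℝ) :
    (N.lap θs).IsHermitian := by
  refine Matrix.IsHermitian.ext fun i j => ?_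
  rw [star_trivial]
  exact lap_symm hY θs j i

/-- The quadratic form of `L(θ*)` is the printed Hessian form. [cite: SimpsonporcoDorflerBullo2013, §3 proof of Theorem 2 (b)] -/
private theorem dotProduct_lap_mulVec' (θs v : Fin n → ℝ) :
    v ⬝ᵥ (N.lap θs *ᵥ v) = ∑ i, v i * ∑ j, N.linWeight θs i j * (v i - v j) := by
  simp only [dotProduct, lap_mulVec]

/-- **The type of a droop / (Aux) fixed point, modulo the rotation** (`|Y|` symmetric, `D_i > 0`, the
reduced linearised Laplacian `L(θ*)_ref` — reference node `i₀` deleted — nonsingular): the complex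
characteristic roots of `auxJac θ* = −D⁻¹L(θ*)` number `#{negative eigenvalues of L_ref}` with positive
real part (the TYPE of `θ*`), `#{positive eigenvalues of L_ref}` with negative real part, and exactly one
on the imaginary axis (the rotation `𝟙`).  Theorem 6.7 (R1): «(δ) is a type-k equilibrium point of the
dimension-reduction system» iff the reduced Hessian has index `k`.
[cite: Chiang1995, §6.2 system (6.3) and §6 Thm 6.7 (R1); SimpsonporcoDorflerBullo2013, §3 proof of Theorem 2 (b) («`d(Δθ_I)/dt = −D_I⁻¹L_red(θ*)Δθ_I`»)] -/
theorem countP_roots_charpoly_auxJac_modRotation (hY : ∀ i j, N.Yabs i j = N.Yabs j i)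
    (hD : ∀ i, 0 < N.Dc i) (θs : Fin n → ℝ) (i₀ : Fin n)
    (hHm : (refMinor (N.lap θs) i₀).IsHermitian)
    (hreg : ∀ u : {k : Fin n // k ≠ i₀} → ℝ, refMinor (N.lap θs) i₀ *ᵥ u = 0 → u = 0) :
    ((N.auxJac θs).map (algebraMap ℝ ℂ)).charpoly.roots.countP (fun μ => 0 < μ.re)
        = #{k | hHm.eigenvalues k < 0} ∧
      ((N.auxJac θs).map (algebraMap ℝ ℂ)).charpoly.roots.countP (fun μ => μ.re < 0)
        = #{k | 0 < hHm.eigenvalues k} ∧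
      ((N.auxJac θs).map (algebraMap ℝ ℂ)).charpoly.roots.countP (fun μ => μ.re = 0) = 1 := by
  rw [auxJac_eq_firstOrderJac]
  exact countP_roots_charpoly_firstOrderJac_of_rowSum_zero (lap_isHermitian hY θs) (sum_lap_row θs)
    hD i₀ hHm hreg

/-- **Type 0 from the PSD + kernel certificate** (the printed road: `L(θ*) ⪰ 0` with kernel the
constants, e.g. on the arc): counts `(0, n − 1, 1)` — «the reduced Laplacian `L_red(θ*)` is positive
definite … all eigenvalues are real and negative», plus the rotation.
[cite: SimpsonporcoDorflerBullo2013, §3 proof of Theorem 2 (b); DorflerChertkovBullo2013, SI §3.1 Lemma 2 (2)] -/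
theorem typeZero_auxJac_of_posCurvature (hY : ∀ i j, N.Yabs i j = N.Yabs j i)
    (hD : ∀ i, 0 < N.Dc i) {θs : Fin n → ℝ}
    (hpsd : ∀ u : Fin n → ℝ, 0 ≤ ∑ i, u i * ∑ j, N.linWeight θs i j * (u i - u j))
    (hker : ∀ u : Fin n → ℝ, ∑ i, u i * ∑ j, N.linWeight θs i j * (u i - u j) = 0 →
      ∃ a : ℝ, u = fun _ => a) (i₀ : Fin n) :
    ((N.auxJac θs).map (algebraMap ℝ ℂ)).charpoly.roots.countP (fun μ => 0 < μ.re) = 0 ∧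
      ((N.auxJac θs).map (algebraMap ℝ ℂ)).charpoly.roots.countP (fun μ => μ.re < 0) = n - 1 ∧
      ((N.auxJac θs).map (algebraMap ℝ ℂ)).charpoly.roots.countP (fun μ => μ.re = 0) = 1 := by
  have hform : ∀ v : Fin n → ℝ, (∃ i j, v i ≠ v j) → 0 < v ⬝ᵥ (N.lap θs *ᵥ v) := by
    intro v hv
    rw [dotProduct_lap_mulVec']
    refine lt_of_le_of_ne (hpsd v) fun h => ?_
    obtain ⟨a, ha⟩ := hker v h.symm
    obtain ⟨i, j, hij⟩ := hv
    exact hij (by rw [ha])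
  have h := typeZero_firstOrderJac_of_form_pos (lap_isHermitian hY θs) (sum_lap_row θs) hD i₀ hform
  rw [Fintype.card_fin] at h
  rw [auxJac_eq_firstOrderJac]
  exact h

/-- **Type 0 on the arc**: `a ≥ 0` with a connected coupling graph, `|θ*_i − θ*_j| < π/2` across every
line — the hypothesis of Theorem 2 (b) — gives counts `(0, n − 1, 1)`.
[cite: SimpsonporcoDorflerBullo2013, §3 Theorem 2 (b) and its proof; DorflerChertkovBullo2013, SI §3.1 Lemma 2] -/
theorem typeZero_auxJac_of_arc (ha : ∀ i j, 0 ≤ N.a i j) (hconn : ClassicalModel.CouplingConnected N.a)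
    (hY : ∀ i j, N.Yabs i j = N.Yabs j i) (hD : ∀ i, 0 < N.Dc i) {θs : Fin n → ℝ}
    (harc : ∀ i j, i ≠ j → 0 < N.a i j → |θs i - θs j| < Real.pi / 2) (i₀ : Fin n) :
    ((N.auxJac θs).map (algebraMap ℝ ℂ)).charpoly.roots.countP (fun μ => 0 < μ.re) = 0 ∧
      ((N.auxJac θs).map (algebraMap ℝ ℂ)).charpoly.roots.countP (fun μ => μ.re < 0) = n - 1 ∧
      ((N.auxJac θs).map (algebraMap ℝ ℂ)).charpoly.roots.countP (fun μ => μ.re = 0) = 1 := by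
  obtain ⟨hpsd, hker⟩ := posCurvature_of_arc ha hconn hY harc
  exact typeZero_auxJac_of_posCurvature hY hD hpsd hker i₀

/-- **Maximal type**: if the Hessian form is negative on every non-constant vector, the counts are
`(n − 1, 0, 1)` — every transversal direction of the fixed point is unstable.
[cite: Chiang1995, §6 Thm 6.7 (R1); ManikTimmeWitthaut2017, §2 Lemma 1 (unstable direction)] -/
theorem typeMax_auxJac_of_negCurvature (hY : ∀ i j, N.Yabs i j = N.Yabs j i)
    (hD : ∀ i, 0 < N.Dc i) {θs : Fin n → ℝ}
    (hform : ∀ v : Fin n → ℝ, (∃ i j, v i ≠ v j) →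
      ∑ i, v i * ∑ j, N.linWeight θs i j * (v i - v j) < 0) (i₀ : Fin n) :
    ((N.auxJac θs).map (algebraMap ℝ ℂ)).charpoly.roots.countP (fun μ => 0 < μ.re) = n - 1 ∧
      ((N.auxJac θs).map (algebraMap ℝ ℂ)).charpoly.roots.countP (fun μ => μ.re < 0) = 0 ∧
      ((N.auxJac θs).map (algebraMap ℝ ℂ)).charpoly.roots.countP (fun μ => μ.re = 0) = 1 := by
  have hform' : ∀ v : Fin n → ℝ, (∃ i j, v i ≠ v j) → v ⬝ᵥ (N.lap θs *ᵥ v) < 0 := by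
    intro v hv
    rw [dotProduct_lap_mulVec']
    exact hform v hv
  have h := typeMax_firstOrderJac_of_form_neg (lap_isHermitian hY θs) (sum_lap_row θs) hD i₀ hform'
  rw [Fintype.card_fin] at h
  rw [auxJac_eq_firstOrderJac]
  exact h

end DroopNetwork

namespace NonuniformKuramoto

variable {n : ℕ} {K : NonuniformKuramoto n}

/-- **The type of a Kuramoto fixed point** (lossless non-uniform Kuramoto model, symmetric weights
`P`, `D_i > 0`; linearisation `−D⁻¹L(θ*)` with weights `P_ij cos(θ*_i − θ*_j)` =
`K.toDroopNetwork.auxJac θ*`): root counts `(#{λ(L_ref) < 0}, #{λ(L_ref) > 0}, 1)` for the reduced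
linearised Laplacian off any reference oscillator `i₀` (nonsingular).
[cite: ManikTimmeWitthaut2017, §2 Lemma 1 («Kuramoto system»); Chiang1995, §6 Thm 6.7 (R1); DorflerChertkovBullo2013, SI §3.1 Lemma 2] -/
theorem countP_roots_charpoly_toDroopNetwork_auxJac (hP : ∀ i j, K.P i j = K.P j i)
    (hD : ∀ i, 0 < K.D i) (θs : Fin n → ℝ) (i₀ : Fin n)
    (hHm : (refMinor (K.toDroopNetwork.lap θs) i₀).IsHermitian)
    (hreg : ∀ u : {k : Fin n // k ≠ i₀} → ℝ, refMinor (K.toDroopNetwork.lap θs) i₀ *ᵥ u = 0 → u = 0) :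
    ((K.toDroopNetwork.auxJac θs).map (algebraMap ℝ ℂ)).charpoly.roots.countP (fun μ => 0 < μ.re)
        = #{k | hHm.eigenvalues k < 0} ∧
      ((K.toDroopNetwork.auxJac θs).map (algebraMap ℝ ℂ)).charpoly.roots.countP (fun μ => μ.re < 0)
        = #{k | 0 < hHm.eigenvalues k} ∧
      ((K.toDroopNetwork.auxJac θs).map (algebraMap ℝ ℂ)).charpoly.roots.countP (fun μ => μ.re = 0)
        = 1 :=
  DroopNetwork.countP_roots_charpoly_auxJac_modRotation (N := K.toDroopNetwork) (fun i j => hP i j)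
    (fun i => hD i) θs i₀ hHm hreg

/-- **Type 0 of a Kuramoto fixed point from the PSD + kernel certificate** on the form
`u ↦ Σ_i u_i Σ_j P_ij cos(θ*_i − θ*_j)(u_i − u_j)`: counts `(0, n − 1, 1)` — the spectral content of
MTW2017 Lemma 1's stable clause / DCB2013 SI Lemma 2 (2).
[cite: ManikTimmeWitthaut2017, §2 Lemma 1; DorflerChertkovBullo2013, SI §3.1 Lemma 2 (2)] -/
theorem typeZero_toDroopNetwork_auxJac_of_posCurvature (hP : ∀ i j, K.P i j = K.P j i)
    (hD : ∀ i, 0 < K.D i) {θ₀ : Fin n → ℝ}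
    (hpsd : ∀ u : Fin n → ℝ, 0 ≤ ∑ i, u i * ∑ j, K.P i j * Real.cos (θ₀ i - θ₀ j) * (u i - u j))
    (hker : ∀ u : Fin n → ℝ, ∑ i, u i * ∑ j, K.P i j * Real.cos (θ₀ i - θ₀ j) * (u i - u j) = 0 →
      ∃ a : ℝ, u = fun _ => a) (i₀ : Fin n) :
    ((K.toDroopNetwork.auxJac θ₀).map (algebraMap ℝ ℂ)).charpoly.roots.countP (fun μ => 0 < μ.re)
        = 0 ∧
      ((K.toDroopNetwork.auxJac θ₀).map (algebraMap ℝ ℂ)).charpoly.roots.countP (fun μ => μ.re < 0)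
        = n - 1 ∧
      ((K.toDroopNetwork.auxJac θ₀).map (algebraMap ℝ ℂ)).charpoly.roots.countP (fun μ => μ.re = 0)
        = 1 := by
  have hY : ∀ i j, K.toDroopNetwork.Yabs i j = K.toDroopNetwork.Yabs j i := fun i j => hP i j
  have hD' : ∀ i, 0 < K.toDroopNetwork.Dc i := fun i => hD i
  have hpsd' : ∀ u : Fin n → ℝ,
      0 ≤ ∑ i, u i * ∑ j, K.toDroopNetwork.linWeight θ₀ i j * (u i - u j) := fun u => by
    simpa only [toDroopNetwork_linWeight] using hpsd u
  have hker' : ∀ u : Fin n → ℝ,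
      ∑ i, u i * ∑ j, K.toDroopNetwork.linWeight θ₀ i j * (u i - u j) = 0 →
      ∃ a : ℝ, u = fun _ => a := fun u hu => by
    refine hker u ?_
    simpa only [toDroopNetwork_linWeight] using hu
  exact DroopNetwork.typeZero_auxJac_of_posCurvature hY hD' hpsd' hker' i₀

/-- **Maximal type of a Kuramoto fixed point**: a negative form off the constants gives `(n − 1, 0, 1)`.
[cite: ManikTimmeWitthaut2017, §2 Lemma 1 (unstable direction); Chiang1995, §6 Thm 6.7 (R1)] -/
theorem typeMax_toDroopNetwork_auxJac_of_negCurvature (hP : ∀ i j, K.P i j = K.P j i)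
    (hD : ∀ i, 0 < K.D i) {θ₀ : Fin n → ℝ}
    (hform : ∀ v : Fin n → ℝ, (∃ i j, v i ≠ v j) →
      ∑ i, v i * ∑ j, K.P i j * Real.cos (θ₀ i - θ₀ j) * (v i - v j) < 0) (i₀ : Fin n) :
    ((K.toDroopNetwork.auxJac θ₀).map (algebraMap ℝ ℂ)).charpoly.roots.countP (fun μ => 0 < μ.re)
        = n - 1 ∧
      ((K.toDroopNetwork.auxJac θ₀).map (algebraMap ℝ ℂ)).charpoly.roots.countP (fun μ => μ.re < 0)
        = 0 ∧
      ((K.toDroopNetwork.auxJac θ₀).map (algebraMap ℝ ℂ)).charpoly.roots.countP (fun μ => μ.re = 0)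
        = 1 := by
  have hY : ∀ i j, K.toDroopNetwork.Yabs i j = K.toDroopNetwork.Yabs j i := fun i j => hP i j
  have hD' : ∀ i, 0 < K.toDroopNetwork.Dc i := fun i => hD i
  have hform' : ∀ v : Fin n → ℝ, (∃ i j, v i ≠ v j) →
      ∑ i, v i * ∑ j, K.toDroopNetwork.linWeight θ₀ i j * (v i - v j) < 0 := fun v hv => by
    simpa only [toDroopNetwork_linWeight] using hform v hv
  exact DroopNetwork.typeMax_auxJac_of_negCurvature hY hD' hform' i₀

end NonuniformKuramoto

end Literature.MathematicalPhysics.PowerSystems
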